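import Summits.BirchSwinnertonDyer.BirchSwinnertonDyer.Theorems.EisensteinPrimesCharDualExactCount
import Summits.BirchSwinnertonDyer.BirchSwinnertonDyer.Theorems.EisensteinPrimesCharResidualSelmerKummer
import HarnessLib

/-!
# `#R_v̄^{S₀}(K_∞, 𝔽(θ̄)) = #H¹_{𝓕_Gr^{S₀}}(K_∞, (F/𝒪)(θ))[p] = p^{λ(𝔛^{S₀}_{θ,Gr})} · #𝔛^{S₀}_{θ,Gr}[p]` — the STRICT
# (Greenberg, CGLS `𝓕_Gr`) residual count of a character over the anticyclotomic tower
# (cell `bsd-eis`, seat `bsd-line-x2-p2` gen 6, D-0154 KEY row 5; crux 4 `BSDpOnCellC` stmt-BirchSwinnertonDyer-19034, line b1;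
# the `𝓕_Gr`-twin of the x1 cell's bricks (a) `…CharDualExactCount` (LEAD g3, p639105) and (b) `…CharResidualSelmerKummer`
# (w4 gen 3) for Keller–Yin's `𝓕_nr`)

HONEST FRAMING (cell `bsd-eis`, run/shared/lean/pub/bsd-eis/): Galois-cohomology / module-theoretic bookkeeping on constructed
objects; no definition, no named fact, no `sorry`, no `Theses` import; nothing about BSD or a main conjecture is asserted; nothing
booked; no label or count moves. Helper `--supports stmt-BirchSwinnertonDyer-19034`; closes no stub.

## Why the STRICT twin
The crux-4 residual λ-identity at a non-split multiplicative Eisenstein prime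
(`…ResidualDevissageNonsplitSurjective.pow_lambdaInvariant_mul_eq_of_prop14_of_cor126`, this seat) reads
`p^{λ(X_ac^{Sf}(E_K))} · #X[p] = #R(S) · #R(E_K[p]/S)` with `R(·)` Castella's STRICT-at-`v̄` residual groups
`datumStrictSelmer (ker κ) · p (bdpData · p v̄) Sf` of the two residual CHARACTERS `S ≅ 𝔽(φ̄)`, `E_K[p]/S ≅ 𝔽(ψ̄)`. The
published character-level main-conjecture input (CGLS22 §1.2, Prop. 1.2.5: `𝔛_θ^S := H¹_{𝓕_Gr^S}(K, M_θ)^∨` is `Λ`-torsion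
with `μ = 0`, `dim_𝔽 H¹_{𝓕_Gr^S}(K, M_θ[p]) = λ(𝔛_θ^S)`) is about the duals of the STRICT (`𝓕_Gr`) Selmer groups of the
divisible character modules — in the tree `KellerYin2024.GrDualData κ (charModule ∅ θ) v̄ S₀ γ`, the dual of `grSelmer`. This file
converts the residual count of `A ≅ 𝔽(θ̄)` into that currency, for ANY `ℤ_p`-extension `κ`, ANY `v̄`, ANY `S₀`, with NO hypothesis
on `θ` at `v̄` (the x1 cell does the same for `unrSelmer`/`DatumDualData`, KY's `𝓕_nr`; for `θ|_{G_v̄} ≠ 𝟙` the two agree,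
which is not used here):

* §1 `GrDualData.natCard_modN_eq_natCard_pTorsion`, **`GrDualData.pow_lambdaInvariant_mul_natCard_pTorsion_eq`** — for a
  strict dual datum `D` finitely generated `Λ`-torsion with `μ = 0`: `p^{λ(D.X)} · #D.X[p] = #H¹_{𝓕_Gr^{S₀}}(K_∞, M)[p]`
  (brick (a) verbatim with `grSelmer` for `datumSelmerInfty`: `μ = 0` ⟹ f.g. over `ℤ_p`, Herbrand, Pontryagin).
* §2 `comap_grSelmer_eq_residualStrictSelmer` — along an equivariant `j : A ↪ (F/𝒪)(θ)` onto the `p`-torsion (`θ^{p−1} = 1`),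
  `j_*⁻¹(H¹_{𝓕_Gr^{S₀}}(K_∞, (F/𝒪)(θ))) = R_v̄^{S₀}(K_∞, A)`: each defining condition reflects along `j_*` (w4's
  `mem_unramifiedKer_iff_resH1Hom_id_mem`, `mem_strictKer_strictDatum_iff_resH1Hom_id_mem`; the relaxed places are vacuous).
* §3 **`natCard_residualStrictSelmer_eq_natCard_grSelmer_pTorsion`** — `j_*` is a BIJECTION `R_v̄^{S₀}(K_∞, A) ≅
  H¹_{𝓕_Gr^{S₀}}(K_∞, (F/𝒪)(θ))[p]` (injective: LEAD's `resH1Hom_id_injective_charModule`; onto the `p`-torsion: w4's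
  `exists_resH1Hom_id_eq_of_nsmul_eq_zero`, `(F/𝒪)(θ)` being `p`-divisible; `pA = 0`); hence the `Nat.card` identity
  (unconditional; both sides `0` if infinite).
* §4 **`natCard_residualStrictSelmer_eq_pow_lambdaInvariant_mul`** — `#R_v̄^{S₀}(K_∞, A) = p^{λ(D.X)} · #D.X[p]` for every strict
  dual datum `D` of `(F/𝒪)(θ)` that is finitely generated `Λ`-torsion with `μ = 0` (CGLS Prop. 1.2.5's first clause is exactly
  this hypothesis for `θ|_{G_v̄} ≠ 𝟙, ω`; its last clause says moreover `D.X[p] = 0`).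

References: [CastellaGrossiLeeSkinner2022] §1.2 Def. 1.2.1, Lemma 1.2.4, Prop. 1.2.5 (e-print TeX L594–712; arXiv:2008.02571 Def. 10,
Lemma 13, Prop. 14); [KellerYin2024] Lemma 1.2.4, §1.4 Lemma `Seltolambda` (arXiv:2402.12781v2 TeX L760–778, L1162–1181);
[GreenbergVatsal2000] §2 Prop. (2.8); [Washington1997] §13.2; cell p639105 (x1 LEAD g3), `…CharResidualSelmerKummer` (x1-p1-w4 g3),
p634599.
-/

set_option autoImplicit false
set_option linter.dupNamespace false -- the summit namespace `…BirchSwinnertonDyer.BirchSwinnertonDyer.Theorems` (Sub = Summit, D-0017) trips it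

noncomputable section

open scoped Classical

namespace Summit.BirchSwinnertonDyer.BirchSwinnertonDyer.Theorems.CharResidualStrictSelmerCount

open NumberField IsDedekindDomain Field
open Literature.NumberTheory.EllipticCurves Literature.NumberTheory.EllipticCurves.IwasawaAlgebra
  Literature.NumberTheory.EllipticCurves.GreenbergSelmer Literature.NumberTheory.EllipticCurves.GreenbergVatsal2000
  Literature.NumberTheory.GaloisRepresentations Literature.NumberTheory.EllipticCurves.KellerYin2024
  Literature.NumberTheory.EllipticCurves.FineSelmerCoefficientMap
  Summit.BirchSwinnertonDyer.BirchSwinnertonDyer.Theorems Summit.BirchSwinnertonDyer.Rank1Residual.Iwasawa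
  Summit.BirchSwinnertonDyer.Rank1Residual.X11b
  Summit.BirchSwinnertonDyer.BirchSwinnertonDyer.Theorems.CharResidualSelmerFinite
  Summit.BirchSwinnertonDyer.BirchSwinnertonDyer.Theorems.CharResidualSelmerCount
  Summit.BirchSwinnertonDyer.BirchSwinnertonDyer.Theorems.UniversalToricDescentResidualSelmer

/-! ### §1 Pontryagin + Herbrand for a STRICT dual datum -/

section Dual

variable {K : Type} [Field K] [NumberField K] {p : ℕ} [hp : Fact p.Prime] {κ : ZpExtension K p}
  {γ : absoluteGaloisGroup K} {M : Type} [AddCommGroup M] [DistribMulAction (absoluteGaloisGroup K) M]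
  [TopologicalSpace M] [DiscreteTopology M] {vbar : HeightOneSpectrum (𝓞 K)} {S₀ : Set (HeightOneSpectrum (𝓞 K))}

/-- **`#(X/pX) = #H¹_{𝓕_Gr^{S₀}}(K_∞, M)[p]` for a strict dual datum `X = D.X`** (Pontryagin, unconditional): transport
`X/pX ≅ Hom(Sel, ℚ/ℤ)/p` along `toDual`, then `#(Hom(Sel, ℚ/ℤ)/p) = #Sel[p]` (`Iwasawa.natCard_modN_characterModule_eq`). Twin of
`CharDualExactCount.natCard_modN_eq_natCard_pTorsion`. [cite: GreenbergVatsal2000, §2 p. 17] [cite: Washington1997, §13.2] -/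
theorem GrDualData.natCard_modN_eq_natCard_pTorsion (D : GrDualData κ M vbar S₀ γ) :
    Nat.card (ModN D.X p) = Nat.card {s : grSelmer κ M vbar S₀ // p • s = 0} := by
  let e : D.X ≃ₗ[ℤ] CharacterModule (grSelmer κ M vbar S₀) :=
    (AddEquiv.ofBijective D.toDual D.bijective).toIntLinearEquiv
  have hmap : (LinearMap.range (LinearMap.lsmul ℤ D.X p)).map (e : D.X →ₗ[ℤ] _) =
      LinearMap.range (LinearMap.lsmul ℤ (CharacterModule (grSelmer κ M vbar S₀)) p) := by
    ext χ
    simp only [Submodule.mem_map, LinearMap.mem_range, LinearMap.lsmul_apply]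
    constructor
    · rintro ⟨x, ⟨a, rfl⟩, rfl⟩
      exact ⟨e a, by change (p : ℤ) • e a = e ((p : ℤ) • a); rw [map_zsmul]⟩
    · rintro ⟨b, rfl⟩
      exact ⟨(p : ℤ) • e.symm b, ⟨e.symm b, rfl⟩, by
        change e ((p : ℤ) • e.symm b) = (p : ℤ) • b
        rw [map_zsmul, LinearEquiv.apply_symm_apply]⟩
  rw [Nat.card_congr (Submodule.Quotient.equiv _ _ e hmap).toEquiv, natCard_modN_characterModule_eq]
  exact Nat.card_congr (Equiv.subtypeEquivRight fun s ↦ AddSubgroup.torsionBy.nsmul_iff)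

/-- **`p^{λ(X)} · #X[p] = #H¹_{𝓕_Gr^{S₀}}(K_∞, M)[p]` for a finitely generated torsion STRICT dual datum `X = D.X` with `μ = 0`** —
the `𝓕_Gr`-twin of `CharDualExactCount.pow_lambdaInvariant_mul_natCard_pTorsion_eq` (`μ = 0` ⟹ f.g. over `ℤ_p`; Herbrand
`#(X/pX) = p^λ · #X[p]`; Pontryagin). CGLS: «`dim_𝔽 H¹_{𝓕_Gr}^S(K, M_θ[p]) = λ(𝔛_θ^S)`» when moreover `𝔛_θ^S` is `ℤ_p`-free.
[cite: CastellaGrossiLeeSkinner2022, §1.2 Prop. 1.2.5 (e-print TeX L681–712; arXiv:2008.02571 Prop. 14)]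
[cite: KellerYin2024, §1.4 (arXiv:2402.12781v2 TeX L1162–1170)] [cite: Washington1997, §13.2] -/
theorem GrDualData.pow_lambdaInvariant_mul_natCard_pTorsion_eq (D : GrDualData κ M vbar S₀ γ)
    [Module.Finite (IwasawaAlgebra p) D.X] (hT : Module.IsTorsion (IwasawaAlgebra p) D.X)
    (hμ : muInvariant p D.X = 0) :
    p ^ lambdaInvariant p D.X * Nat.card {x : D.X // p • x = 0} =
      Nat.card {s : grSelmer κ M vbar S₀ // p • s = 0} := by
  letI : Module ℤ_[p] D.X := Module.compHom D.X (algebraMap ℤ_[p] (IwasawaAlgebra p))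
  haveI : IsScalarTower ℤ_[p] (IwasawaAlgebra p) D.X := IsScalarTower.of_compHom _ _ _
  haveI : Module.Finite ℤ_[p] D.X := (muInvariant_eq_zero_iff_finite p D.X hT).mp hμ
  have hsm : ∀ x : D.X, (p : ℤ_[p]) • x = p • x := fun x ↦ by
    change (algebraMap ℤ_[p] (IwasawaAlgebra p) (p : ℤ_[p])) • x = _
    rw [map_natCast, Nat.cast_smul_eq_nsmul]
  have hH := LambdaLowerBound.natCard_quotient_eq_pow_lambdaInvariant_mul_natCard_ker p D.X
  have h2 : Nat.card (D.X ⧸ LinearMap.range (LinearMap.lsmul ℤ_[p] D.X p)) =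
      Nat.card (D.X ⧸ (Ideal.span {(p : ℤ_[p])} • ⊤ : Submodule ℤ_[p] D.X)) :=
    Nat.card_congr (Submodule.quotEquivOfEq _ _
      (LambdaLowerBound.span_smul_top_eq_range_lsmul p D.X).symm).toEquiv
  have h3 : Nat.card (D.X ⧸ (Ideal.span {(p : ℤ_[p])} • ⊤ : Submodule ℤ_[p] D.X)) =
      Nat.card (D.X ⧸ (Ideal.span {PowerSeries.C (p : ℤ_[p])} • ⊤ : Submodule (IwasawaAlgebra p) D.X)) := by
    change Nat.card (D.X ⧸ (Ideal.span {(p : ℤ_[p])} • ⊤ : Submodule ℤ_[p] D.X).toAddSubgroup) =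
      Nat.card (D.X ⧸ (Ideal.span {PowerSeries.C (p : ℤ_[p])} • ⊤ :
        Submodule (IwasawaAlgebra p) D.X).toAddSubgroup)
    rw [PrintCFram.LambdaResidualBound.toAddSubgroup_pSmul_eq p D.X]
  have h4 : Nat.card (D.X ⧸ (Ideal.span {PowerSeries.C (p : ℤ_[p])} • ⊤ : Submodule (IwasawaAlgebra p) D.X)) =
      Nat.card {s : grSelmer κ M vbar S₀ // p • s = 0} := by
    rw [show (Ideal.span {PowerSeries.C (p : ℤ_[p])} : Ideal (IwasawaAlgebra p)) = augIdealP p from rfl,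
      natCard_quotient_augIdealP_smul_top_eq_natCard_modN p, GrDualData.natCard_modN_eq_natCard_pTorsion]
  have h5 : Nat.card (LinearMap.ker (LinearMap.lsmul ℤ_[p] D.X p)) = Nat.card {x : D.X // p • x = 0} :=
    Nat.card_congr (Equiv.subtypeEquivRight fun x ↦ by rw [LinearMap.mem_ker, LinearMap.lsmul_apply, hsm])
  rw [← h5, ← hH, h2, h3, h4]

end Dual

/-! ### §2 The Selmer conditions reflect along `j_*`: `j_*⁻¹(H¹_{𝓕_Gr^{S₀}}(K_∞, (F/𝒪)(θ))) = R_v̄^{S₀}(K_∞, A)` -/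

section Kummer

variable {K : Type} [Field K] [NumberField K] {p : ℕ} [hp : Fact p.Prime]
  (θ : FramedGaloisRep K (padicCoeffIntegers (∅ : Set (PadicAlgCl p))) 1)
  (κ : ZpExtension K p) (vbar : HeightOneSpectrum (𝓞 K)) (S₀ : Set (HeightOneSpectrum (𝓞 K)))

variable {A : Type} [AddCommGroup A] [DistribMulAction (absoluteGaloisGroup K) A] [TopologicalSpace A]
  [DiscreteTopology A]

/-- **`j_*⁻¹(H¹_{𝓕_Gr^{S₀}}(K_∞, (F/𝒪)(θ))) = R_v̄^{S₀}(K_∞, A)`** for `j : A ↪ (F/𝒪)(θ)` equivariant onto the `p`-torsion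
(`θ^{p−1} = 1`; any `ℤ_p`-extension `κ`, any `v̄`, any `S₀`): the unramified conditions off `S₀ ∪ {w ∣ p}` and Castella's strict
condition at `v̄` reflect along `j_*` conjugate by conjugate (w4's `mem_unramifiedKer_iff_resH1Hom_id_mem`,
`mem_strictKer_strictDatum_iff_resH1Hom_id_mem`, and `conjH1_comp_resH1Hom_id`); the other places above `p` carry no condition
on either side. [cite: KellerYin2024, Lemma 1.2.4 (arXiv:2402.12781v2 TeX L760–778)] [cite: CastellaGrossiLeeSkinner2022, §1.2 Lemma 1.2.4 `rmkchar` (e-print TeX L660–678)] -/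
theorem comap_grSelmer_eq_residualStrictSelmer
    (hθ : ∀ σ : absoluteGaloisGroup K, θ σ ^ (p - 1) = 1)
    (j : A →+ charModule (∅ : Set (PadicAlgCl p)) θ)
    (hj : ∀ (σ : absoluteGaloisGroup K) (a : A), j (σ • a) = σ • j a) (hinj : Function.Injective j)
    (hrange : ∀ x : charModule (∅ : Set (PadicAlgCl p)) θ, x ∈ j.range ↔ p • x = 0) :
    (grSelmer κ (charModule (∅ : Set (PadicAlgCl p)) θ) vbar S₀).comap
        (resH1Hom (ContinuousMonoidHom.id κ.kerSubgroup) j (fun g a ↦ hj (g : absoluteGaloisGroup K) a)) =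
      datumStrictSelmer κ.kerSubgroup A p (AcSelmer.bdpData A p vbar) S₀ := by
  -- notation
  let H := κ.kerSubgroup
  let B := charModule (∅ : Set (PadicAlgCl p)) θ
  have hjH : ∀ (g : H) (a : A), j (ContinuousMonoidHom.id H g • a) = g • j a :=
    fun g a ↦ hj (g : absoluteGaloisGroup K) a
  let jH := resH1Hom (ContinuousMonoidHom.id H) j hjH
  have hconj : ∀ (σ : absoluteGaloisGroup K) (c : subgroupH1 H A), conjH1 H B σ (jH c) = jH (conjH1 H A σ c) :=
    fun σ c ↦ congrArg (fun f : subgroupH1 H A →+ subgroupH1 H B ↦ f c) (conjH1_comp_resH1Hom_id H j hjH hj σ)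
  ext c
  rw [AddSubgroup.mem_comap]
  change jH c ∈ datumStrictSelmer H B p (Castella2018.AcSelmer.bdpData B p vbar) S₀ ↔
    c ∈ datumStrictSelmer H A p (AcSelmer.bdpData A p vbar) S₀
  rw [mem_datumStrictSelmer_iff, mem_datumStrictSelmer_iff, mem_unramifiedOutside_iff, mem_unramifiedOutside_iff]
  refine and_congr (forall₄_congr fun v _ _ σ ↦ ?_) (forall₃_congr fun v hv σ ↦ ?_)
  · rw [hconj]
    exact (mem_unramifiedKer_iff_resH1Hom_id_mem θ H hθ v j hj hinj hrange (conjH1 H A σ c)).symm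
  · rw [hconj]
    by_cases hv𝔭 : v = vbar
    · subst hv𝔭
      rw [Castella2018.AcSelmer.bdpData_self p v hv, AcSelmer.bdpData_self p v hv]
      exact (mem_strictKer_strictDatum_iff_resH1Hom_id_mem θ H hθ v j hj hinj hrange (conjH1 H A σ c)).symm
    · rw [Castella2018.AcSelmer.bdpData_of_ne p vbar hv hv𝔭, AcSelmer.bdpData_of_ne p vbar hv hv𝔭,
        Castella2018.AcSelmer.strictKer_relaxedDatum_eq_top, AcSelmer.strictKer_relaxedDatum_eq_top]
      exact ⟨fun _ ↦ AddSubgroup.mem_top _, fun _ ↦ AddSubgroup.mem_top _⟩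

/-! ### §3 The bijection `R_v̄^{S₀}(K_∞, A) ≅ H¹_{𝓕_Gr^{S₀}}(K_∞, (F/𝒪)(θ))[p]` and the count -/

/-- **`#R_v̄^{S₀}(K_∞, A) = #H¹_{𝓕_Gr^{S₀}}(K_∞, (F/𝒪)(θ))[p]`** for `j : A ↪ (F/𝒪)(θ)` equivariant onto the `p`-torsion
(`θ^{p−1} = 1`; any `κ`, `v̄`, `S₀`): `j_*` is injective on `H¹(K_∞, A)` (`resH1Hom_id_injective_charModule`), maps `R(A)` into
the strict group (§2) with `p`-torsion values (`pA = 0`), and every `p`-torsion class of the strict group of `(F/𝒪)(θ)` is `j_*`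
of a class (`exists_resH1Hom_id_eq_of_nsmul_eq_zero`, `(F/𝒪)(θ)` `p`-divisible with continuous orbit maps), which lies in `R(A)` by
§2 — a bijection, hence the `Nat.card` identity (both sides `0` when infinite). KY/CGLS Lemma 1.2.4
«`H¹_{𝓕^S}(K, M_θ[𝔭]) ≅ H¹_{𝓕^S}(K, M_θ)[𝔭]`» for `𝓕 = 𝓕_Gr`, with NO hypothesis on `θ|_{G_v̄}` (only the strict condition is
used, cf. KY: «their assumption `θ|_{G_v̄} ≠ 𝟙` is not essential»).
[cite: KellerYin2024, Lemma 1.2.4 (arXiv:2402.12781v2 TeX L720–778)] [cite: CastellaGrossiLeeSkinner2022, §1.2 Lemma 1.2.4 (e-print TeX L660–678; arXiv Lemma 13)] -/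
theorem natCard_residualStrictSelmer_eq_natCard_grSelmer_pTorsion
    (hθ : ∀ σ : absoluteGaloisGroup K, θ σ ^ (p - 1) = 1)
    (j : A →+ charModule (∅ : Set (PadicAlgCl p)) θ)
    (hj : ∀ (σ : absoluteGaloisGroup K) (a : A), j (σ • a) = σ • j a) (hinj : Function.Injective j)
    (hrange : ∀ x : charModule (∅ : Set (PadicAlgCl p)) θ, x ∈ j.range ↔ p • x = 0) :
    Nat.card (datumStrictSelmer κ.kerSubgroup A p (AcSelmer.bdpData A p vbar) S₀) =
      Nat.card {s : grSelmer κ (charModule (∅ : Set (PadicAlgCl p)) θ) vbar S₀ // p • s = 0} := by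
  -- notation
  let H := κ.kerSubgroup
  let B := charModule (∅ : Set (PadicAlgCl p)) θ
  have hjH : ∀ (g : H) (a : A), j (ContinuousMonoidHom.id H g • a) = g • j a :=
    fun g a ↦ hj (g : absoluteGaloisGroup K) a
  let jH := resH1Hom (ContinuousMonoidHom.id H) j hjH
  have hinjH : Function.Injective jH := resH1Hom_id_injective_charModule θ hθ H j hj hinj hrange
  have hcomap := comap_grSelmer_eq_residualStrictSelmer θ κ vbar S₀ hθ j hj hinj hrange
  -- `pA = 0`, so every class of `H¹(H, A)` is `p`-torsion
  have hpA : ∀ a : A, p • a = 0 := fun a ↦ hinj (by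
    rw [map_nsmul, map_zero]; exact (hrange (j a)).mp ⟨a, rfl⟩)
  have hpc : ∀ c : subgroupH1 H A, p • c = 0 := nsmul_discreteH1_eq_zero (G := H) hpA
  have hmem : ∀ c : subgroupH1 H A, c ∈ datumStrictSelmer H A p (AcSelmer.bdpData A p vbar) S₀ →
      jH c ∈ grSelmer κ B vbar S₀ := fun c hc ↦ by
    have h : c ∈ (grSelmer κ B vbar S₀).comap jH := by rw [hcomap]; exact hc
    exact h
  let f : datumStrictSelmer H A p (AcSelmer.bdpData A p vbar) S₀ → {s : grSelmer κ B vbar S₀ // p • s = 0} :=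
    fun c ↦ ⟨⟨jH c.1, hmem c.1 c.2⟩, Subtype.ext (by
      change p • jH c.1 = 0
      rw [← map_nsmul, hpc, map_zero])⟩
  refine Nat.card_congr (Equiv.ofBijective f ⟨fun c c' h ↦ ?_, fun s ↦ ?_⟩)
  · have h' : jH c.1 = jH c'.1 :=
      congrArg (fun s : {s : grSelmer κ B vbar S₀ // p • s = 0} ↦ ((s.1 : grSelmer κ B vbar S₀) : subgroupH1 H B)) h
    exact Subtype.ext (hinjH h')
  · obtain ⟨s, hs⟩ := s
    have hs' : p • (s : subgroupH1 H B) = 0 := by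
      rw [← AddSubgroupClass.coe_nsmul, hs, ZeroMemClass.coe_zero]
    obtain ⟨x, hx⟩ := exists_resH1Hom_id_eq_of_nsmul_eq_zero (G := H) j hjH hinj hrange
      (fun b ↦ (continuous_smul_charModule θ b).comp continuous_subtype_val) (charModule_divisible θ)
      (s : subgroupH1 H B) hs'
    have hxR : x ∈ datumStrictSelmer H A p (AcSelmer.bdpData A p vbar) S₀ := by
      rw [← hcomap, AddSubgroup.mem_comap]
      change jH x ∈ grSelmer κ B vbar S₀
      rw [hx]
      exact s.2
    exact ⟨⟨x, hxR⟩, Subtype.ext (Subtype.ext hx)⟩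

/-! ### §4 The residual count in the currency of the strict character dual -/

/-- **`#R_v̄^{S₀}(K_∞, A) = p^{λ(𝔛)} · #𝔛[p]` for every finitely generated `Λ`-torsion STRICT dual datum `𝔛 = D.X` of
`H¹_{𝓕_Gr^{S₀}}(K_∞, (F/𝒪)(θ))` with `μ = 0`** (`j : A ↪ (F/𝒪)(θ)` equivariant onto the `p`-torsion, `θ^{p−1} = 1`; any `κ`, `v̄`,
`S₀`): §3 + §1. In CGLS's notation `dim_𝔽 H¹_{𝓕_Gr^S}(K, M_θ[p]) = λ(𝔛_θ^S) + dim_𝔽 𝔛_θ^S[p]`; Prop. 1.2.5's first clause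
(«`𝔛_θ^S` is a torsion `Λ`-module with `μ`-invariant zero», `θ|_{G_v̄} ≠ 𝟙, ω`) is exactly the hypothesis, its last clause says
the second term vanishes. [cite: CastellaGrossiLeeSkinner2022, §1.2 Prop. 1.2.5, Lemma 1.2.4 (e-print TeX L660–712; arXiv:2008.02571 Lemma 13, Prop. 14)]
[cite: KellerYin2024, Lemma 1.2.4 and §1.4 Lemma (Seltolambda) (arXiv:2402.12781v2)] -/
theorem natCard_residualStrictSelmer_eq_pow_lambdaInvariant_mul
    (hθ : ∀ σ : absoluteGaloisGroup K, θ σ ^ (p - 1) = 1)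
    (j : A →+ charModule (∅ : Set (PadicAlgCl p)) θ)
    (hj : ∀ (σ : absoluteGaloisGroup K) (a : A), j (σ • a) = σ • j a) (hinj : Function.Injective j)
    (hrange : ∀ x : charModule (∅ : Set (PadicAlgCl p)) θ, x ∈ j.range ↔ p • x = 0)
    {γ : absoluteGaloisGroup K} (D : GrDualData κ (charModule (∅ : Set (PadicAlgCl p)) θ) vbar S₀ γ)
    [Module.Finite (IwasawaAlgebra p) D.X] (hT : Module.IsTorsion (IwasawaAlgebra p) D.X)
    (hμ : muInvariant p D.X = 0) :
    Nat.card (datumStrictSelmer κ.kerSubgroup A p (AcSelmer.bdpData A p vbar) S₀) =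
      p ^ lambdaInvariant p D.X * Nat.card {x : D.X // p • x = 0} := by
  rw [natCard_residualStrictSelmer_eq_natCard_grSelmer_pTorsion θ κ vbar S₀ hθ j hj hinj hrange,
    GrDualData.pow_lambdaInvariant_mul_natCard_pTorsion_eq D hT hμ]

/-- **Finiteness in the same currency**: `R_v̄^{S₀}(K_∞, A)` is finite as soon as some strict dual datum of `(F/𝒪)(θ)` is
finitely generated `Λ`-torsion with `μ = 0` (then `#R = p^λ · #𝔛[p] ≠ 0`). The `𝓕_Gr`-twin of
`CharResidualSelmerFinite.finite_residualStrictSelmer_of_dualData`. [cite: CastellaGrossiLeeSkinner2022, §1.2 Prop. 1.2.5 ("Moreover, H¹_{F_Gr}^S(K, M_θ[p]) is finite")] -/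
theorem finite_residualStrictSelmer_of_grDualData
    (hθ : ∀ σ : absoluteGaloisGroup K, θ σ ^ (p - 1) = 1)
    (j : A →+ charModule (∅ : Set (PadicAlgCl p)) θ)
    (hj : ∀ (σ : absoluteGaloisGroup K) (a : A), j (σ • a) = σ • j a) (hinj : Function.Injective j)
    (hrange : ∀ x : charModule (∅ : Set (PadicAlgCl p)) θ, x ∈ j.range ↔ p • x = 0)
    {γ : absoluteGaloisGroup K} (D : GrDualData κ (charModule (∅ : Set (PadicAlgCl p)) θ) vbar S₀ γ)
    [Module.Finite (IwasawaAlgebra p) D.X] (hT : Module.IsTorsion (IwasawaAlgebra p) D.X)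
    (hμ : muInvariant p D.X = 0) :
    (datumStrictSelmer κ.kerSubgroup A p (AcSelmer.bdpData A p vbar) S₀ :
      Set (subgroupH1 κ.kerSubgroup A)).Finite := by
  refine Set.finite_coe_iff.mp (Nat.finite_of_card_ne_zero ?_)
  change Nat.card (datumStrictSelmer κ.kerSubgroup A p (AcSelmer.bdpData A p vbar) S₀) ≠ 0
  rw [natCard_residualStrictSelmer_eq_pow_lambdaInvariant_mul θ κ vbar S₀ hθ j hj hinj hrange D hT hμ]
  letI : Module ℤ_[p] D.X := Module.compHom D.X (algebraMap ℤ_[p] (IwasawaAlgebra p))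
  haveI : IsScalarTower ℤ_[p] (IwasawaAlgebra p) D.X := IsScalarTower.of_compHom _ _ _
  haveI : Module.Finite ℤ_[p] D.X := (muInvariant_eq_zero_iff_finite p D.X hT).mp hμ
  have hsm : ∀ x : D.X, (p : ℤ_[p]) • x = p • x := fun x ↦ by
    change (algebraMap ℤ_[p] (IwasawaAlgebra p) (p : ℤ_[p])) • x = _
    rw [map_natCast, Nat.cast_smul_eq_nsmul]
  haveI : Finite {x : D.X // p • x = 0} := by
    haveI := LambdaLowerBound.finite_torsion p D.X
    have hp0 : (p : ℤ_[p]) ≠ 0 := by exact_mod_cast hp.out.ne_zero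
    let ι : {x : D.X // p • x = 0} → Submodule.torsion ℤ_[p] D.X := fun x ↦
      ⟨x.1, (Submodule.mem_torsion_iff x.1).mpr ⟨⟨(p : ℤ_[p]), mem_nonZeroDivisors_of_ne_zero hp0⟩, by
        change (p : ℤ_[p]) • x.1 = 0
        rw [hsm]
        exact x.2⟩⟩
    exact Finite.of_injective ι fun x y h ↦
      Subtype.ext (congrArg (fun z : Submodule.torsion ℤ_[p] D.X ↦ (z : D.X)) h)
  haveI : Nonempty {x : D.X // p • x = 0} := ⟨⟨0, smul_zero _⟩⟩
  exact mul_ne_zero (pow_ne_zero _ hp.out.ne_zero) (Nat.card_pos (α := {x : D.X // p • x = 0})).ne'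

end Kummer

end Summit.BirchSwinnertonDyer.BirchSwinnertonDyer.Theorems.CharResidualStrictSelmerCount

end
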